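import Summits.Ventures.PercRepro.SixFourPLCov3A

/-!
# PercRepro — C-025 at `(6,4)`, step (4) of `PLJlow`, part B: the covering weights `cw` on the listed traces
(mine-2; pre-cut of `SixFourPLCov3.lean` l.262–551, bodies verbatim)

The step-(4) chain of record (`MINE2-RLS.md` §21.18.9.2, PRECISION 3) is `Xcnt M G ≤ Σ_{covPairs3} 2^{|P ∩ P′ ∩ G|} ≤
X̄(profile D)` (resp. `≤ X̄′(profile D)` at `g = 8, 9`), cut into gate-sized modules: `SixFourPLCovPairs3` (the first
inequality, on the rank-3-trace planes; imports the landed `SixFourT4XA`) and `SixFourPLCov3A → SixFourPLCov3B →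
SixFourPLCov3C → SixFourPLCov3D` (the second inequality as pure finite-set statements; `SixFourPLCov3A` imports the
landed `SixFourPLList`), joined by `SixFourPLSeam` (`Xcnt_le_Xbar_seam`, `Xcnt_le_Xbar'_seam`). The bodies are those of
lean-drafts/mine-2/SixFourPLCov3.lean (1,012 lines, sha16 54cf6c11e44bf06b) verbatim; only the preambles differ.

This part (the first half of `section accounting`): under `h : PLTraceData π ρ L C N`, the covering weight `cw` of every
ordered pair of listed traces — `cw_rho_pi`, `cw_pi_rho` (T1, `2^{s_j}`), `cw_rho_xl`, `cw_xl_rho`, `cw_xl_xl` (never cover,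
`n ≥ 3`), `cw_pi_pi` (T2, covering iff `s_j + s_k = p + e`), `cw_pi_xl_le` (T3, `≤ 4`), `rho_subset_union_iff`,
`card_filter_cov_le` (at most one covering line per class). Imports `SixFourPLCov3A`.
-/

namespace PercRepro.SixFour

open Finset

variable {α : Type*} [DecidableEq α]

section accounting

variable {π : PL.CProf} {ρ L : Finset α} {C N : Finset (Finset α)}

/-- `(L ∪ A) ∩ ρ = A` for `A ⊆ ρ` disjoint from `L`. -/
theorem union_inter_right_eq (hdisj : Disjoint ρ L) {A : Finset α} (hA : A ⊆ ρ) : (L ∪ A) ∩ ρ = A := by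
  rw [Finset.union_inter_distrib_right, Finset.disjoint_iff_inter_eq_empty.1 hdisj.symm, Finset.empty_union]
  exact Finset.inter_eq_left.2 hA

/-- `A ↦ L ∪ A` is injective on subsets of `ρ`. -/
theorem injOn_union_left (hdisj : Disjoint ρ L) (hC : ∀ A ∈ C, A ⊆ ρ) :
    Set.InjOn (fun A : Finset α => L ∪ A) C := by
  intro A hA B hB h
  simp only at h
  rw [← union_inter_right_eq hdisj (hC A hA), ← union_inter_right_eq hdisj (hC B hB), h]

/-- `(insert x l) ∩ L = {x}` for `x ∈ L`, `l ⊆ ρ`. -/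
theorem insert_inter_L (hdisj : Disjoint ρ L) {x : α} (hx : x ∈ L) {l : Finset α} (hl : l ⊆ ρ) :
    insert x l ∩ L = {x} := by
  ext y
  simp only [Finset.mem_inter, Finset.mem_insert, Finset.mem_singleton]
  constructor
  · rintro ⟨hy | hy, hyL⟩
    · exact hy
    · exact absurd hyL (Finset.disjoint_left.1 hdisj (hl hy))
  · rintro rfl
    exact ⟨Or.inl rfl, hx⟩

/-- `(insert x l) ∩ ρ = l` for `x ∈ L`, `l ⊆ ρ`. -/
theorem insert_inter_rho (hdisj : Disjoint ρ L) {x : α} (hx : x ∈ L) {l : Finset α} (hl : l ⊆ ρ) :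
    insert x l ∩ ρ = l := by
  ext y
  simp only [Finset.mem_inter, Finset.mem_insert]
  constructor
  · rintro ⟨hy | hy, hyρ⟩
    · rw [hy] at hyρ
      exact absurd hx (Finset.disjoint_left.1 hdisj hyρ)
    · exact hy
  · intro hy
    exact ⟨Or.inr hy, hl hy⟩

/-- `(x, λ) ↦ insert x λ` is injective on `L ×ˢ N`. -/
theorem injOn_insert (hdisj : Disjoint ρ L) (hN : ∀ l ∈ N, l ⊆ ρ) :
    Set.InjOn (fun q : α × Finset α => insert q.1 q.2) (↑(L ×ˢ N) : Set (α × Finset α)) := by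
  rintro ⟨x, l⟩ hq ⟨x', l'⟩ hq' h
  simp only at h
  rw [Finset.mem_coe, Finset.mem_product] at hq hq'
  have hx : x ∈ L := hq.1
  have hl : l ∈ N := hq.2
  have hx' : x' ∈ L := hq'.1
  have hl' : l' ∈ N := hq'.2
  have h1 : x = x' := by
    have this : insert x l ∩ L = insert x' l' ∩ L := by rw [h]
    rw [insert_inter_L hdisj hx (hN l hl), insert_inter_L hdisj hx' (hN l' hl')] at this
    exact Finset.singleton_injective this
  have h2 : l = l' := by
    have this : insert x l ∩ ρ = insert x' l' ∩ ρ := by rw [h]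
    rw [insert_inter_rho hdisj hx (hN l hl), insert_inter_rho hdisj hx' (hN l' hl')] at this
    exact this
  rw [h1, h2]

/-- `cw ρ ρ = 0`. -/
theorem cw_rho_rho (G : Finset α) : cw G ρ ρ = 0 := by
  unfold cw
  rw [if_neg]
  intro h
  exact h.1 rfl

/-- T1: `(ρ, L ∪ λ_j)` always covers, with weight `2^{s_j}`. -/
theorem cw_rho_pi (h : PLTraceData π ρ L C N) {A : Finset α} (hA : A ∈ C) :
    cw (ρ ∪ L) ρ (L ∪ A) = 2 ^ A.card := by
  unfold cw
  have hne : ρ ≠ L ∪ A := by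
    intro heq
    obtain ⟨x, hx⟩ := Finset.card_pos.1 (by have := h.three_le; omega : 0 < L.card)
    have hxρ : x ∈ ρ := by
      rw [heq]
      exact Finset.mem_union_left _ hx
    exact Finset.disjoint_left.1 h.disj hxρ hx
  have hcov : ρ ∪ L ⊆ ρ ∪ (L ∪ A) := by
    intro y hy
    rw [Finset.mem_union] at hy ⊢
    rw [Finset.mem_union]
    tauto
  rw [if_pos ⟨hne, hcov⟩, Finset.inter_comm, union_inter_right_eq h.disj (h.class_subset A hA)]

/-- T1 reversed. -/
theorem cw_pi_rho (h : PLTraceData π ρ L C N) {A : Finset α} (hA : A ∈ C) :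
    cw (ρ ∪ L) (L ∪ A) ρ = 2 ^ A.card := by
  rw [cw_comm]
  exact cw_rho_pi h hA

/-- T0: `(ρ, {x} ∪ λ)` never covers (`n ≥ 2`). -/
theorem cw_rho_xl (h : PLTraceData π ρ L C N) {x : α} {l : Finset α} (hl : l ∈ N) :
    cw (ρ ∪ L) ρ (insert x l) = 0 := by
  unfold cw
  rw [if_neg]
  rintro ⟨-, hcov⟩
  have hL : L ⊆ {x} := by
    intro y hy
    have hy' := hcov (Finset.mem_union_right _ hy)
    rw [Finset.mem_union, Finset.mem_insert] at hy'
    rcases hy' with hyρ | hyx | hyl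
    · exact absurd hy (Finset.disjoint_left.1 h.disj hyρ)
    · rw [hyx]
      exact Finset.mem_singleton_self _
    · exact absurd hy (Finset.disjoint_left.1 h.disj (h.line_subset l hl hyl))
  have h1 := (Finset.card_le_card hL).trans (Finset.card_singleton x).le
  have h3 := h.three_le
  omega

/-- T0 reversed. -/
theorem cw_xl_rho (h : PLTraceData π ρ L C N) {x : α} {l : Finset α} (hl : l ∈ N) :
    cw (ρ ∪ L) (insert x l) ρ = 0 := by
  rw [cw_comm]
  exact cw_rho_xl h hl

/-- T0: `({x} ∪ λ, {x′} ∪ λ′)` never covers (`n ≥ 3`). -/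
theorem cw_xl_xl (h : PLTraceData π ρ L C N) {x x' : α} {l l' : Finset α}
    (hl : l ∈ N) (hl' : l' ∈ N) : cw (ρ ∪ L) (insert x l) (insert x' l') = 0 := by
  unfold cw
  rw [if_neg]
  rintro ⟨-, hcov⟩
  have hL : L ⊆ {x, x'} := by
    intro y hy
    have hy' := hcov (Finset.mem_union_right _ hy)
    rw [Finset.mem_union, Finset.mem_insert, Finset.mem_insert] at hy'
    rw [Finset.mem_insert, Finset.mem_singleton]
    rcases hy' with (hyx | hyl) | (hyx' | hyl')
    · exact Or.inl hyx
    · exact absurd hy (Finset.disjoint_left.1 h.disj (h.line_subset l hl hyl))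
    · exact Or.inr hyx'
    · exact absurd hy (Finset.disjoint_left.1 h.disj (h.line_subset l' hl' hyl'))
  have h1 := (Finset.card_le_card hL).trans (Finset.card_le_two (a := x) (b := x'))
  have h3 := h.three_le
  omega

/-- T2: `(L ∪ λ_j, L ∪ λ_k)` covers iff `λ_j ≠ λ_k` and `ρ ⊆ λ_j ∪ λ_k`, with weight `2^{n+e}`. -/
theorem cw_pi_pi (h : PLTraceData π ρ L C N) {A B : Finset α} (hA : A ∈ C) (hB : B ∈ C) :
    cw (ρ ∪ L) (L ∪ A) (L ∪ B) = if A ≠ B ∧ ρ ⊆ A ∪ B then 2 ^ (L.card + PL.e π) else 0 := by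
  unfold cw
  have hiff : (L ∪ A ≠ L ∪ B ∧ ρ ∪ L ⊆ L ∪ A ∪ (L ∪ B)) ↔ (A ≠ B ∧ ρ ⊆ A ∪ B) := by
    constructor
    · rintro ⟨hne, hcov⟩
      refine ⟨fun heq => hne (by rw [heq]), ?_⟩
      intro y hy
      have hy' := hcov (Finset.mem_union_left _ hy)
      rw [Finset.mem_union, Finset.mem_union, Finset.mem_union] at hy'
      rw [Finset.mem_union]
      have hyL : y ∉ L := Finset.disjoint_left.1 h.disj hy
      tauto
    · rintro ⟨hne, hcov⟩
      refine ⟨fun heq => hne (injOn_union_left h.disj h.class_subset hA hB heq), ?_⟩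
      intro y hy
      rw [Finset.mem_union] at hy
      rw [Finset.mem_union, Finset.mem_union, Finset.mem_union]
      rcases hy with hy | hy
      · have := hcov hy
        rw [Finset.mem_union] at this
        tauto
      · exact Or.inl (Or.inl hy)
  by_cases hc : A ≠ B ∧ ρ ⊆ A ∪ B
  · rw [if_pos (hiff.2 hc), if_pos hc]
    congr 1
    have heq : (L ∪ A) ∩ (L ∪ B) = L ∪ (A ∩ B) := by
      ext y
      simp only [Finset.mem_inter, Finset.mem_union]
      tauto
    rw [heq, Finset.card_union_of_disjoint, h.class_class A hA B hB hc.1]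
    rw [Finset.disjoint_left]
    intro y hyL hyAB
    exact Finset.disjoint_left.1 h.disj (h.class_subset A hA (Finset.mem_inter.1 hyAB).1) hyL
  · rw [if_neg (fun h' => hc (hiff.1 h')), if_neg hc]

/-- The T2 covering criterion on sizes: for distinct classes, `ρ ⊆ λ_j ∪ λ_k ↔ s_j + s_k = p + e`. -/
theorem rho_subset_union_iff (h : PLTraceData π ρ L C N) {A B : Finset α} (hA : A ∈ C) (hB : B ∈ C)
    (hne : A ≠ B) : ρ ⊆ A ∪ B ↔ A.card + B.card = π.p + PL.e π := by
  have hsub : A ∪ B ⊆ ρ := Finset.union_subset (h.class_subset A hA) (h.class_subset B hB)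
  have hci := Finset.card_union_add_card_inter A B
  rw [h.class_class A hA B hB hne] at hci
  rw [h.p_eq]
  constructor
  · intro hρ
    have : A ∪ B = ρ := Finset.Subset.antisymm hsub hρ
    rw [← this]
    omega
  · intro hsum
    have : A ∪ B = ρ := Finset.eq_of_subset_of_card_le hsub (by omega)
    rw [← this]

/-- T3: `(L ∪ λ_j, {x} ∪ λ)` has weight `≤ 4`, and covers only if `ρ ⊆ λ_j ∪ λ`. -/
theorem cw_pi_xl_le (h : PLTraceData π ρ L C N) {A : Finset α} (hA : A ∈ C) {x : α} (hx : x ∈ L)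
    {l : Finset α} (hl : l ∈ N) :
    cw (ρ ∪ L) (L ∪ A) (insert x l) ≤ if ρ ⊆ A ∪ l then 4 else 0 := by
  unfold cw
  split_ifs with h1 h2
  · have hsub : (L ∪ A) ∩ insert x l ⊆ insert x (A ∩ l) := by
      intro y hy
      rw [Finset.mem_inter, Finset.mem_union, Finset.mem_insert] at hy
      rw [Finset.mem_insert, Finset.mem_inter]
      rcases hy with ⟨hyLA, hyx | hyl⟩
      · exact Or.inl hyx
      · right
        refine ⟨?_, hyl⟩
        rcases hyLA with hyL | hyA
        · exact absurd hyL (Finset.disjoint_left.1 h.disj (h.line_subset l hl hyl))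
        · exact hyA
    have hc : ((L ∪ A) ∩ insert x l).card ≤ 2 := by
      calc ((L ∪ A) ∩ insert x l).card ≤ (insert x (A ∩ l)).card := Finset.card_le_card hsub
        _ ≤ (A ∩ l).card + 1 := Finset.card_insert_le _ _
        _ ≤ 2 := by have := h.class_line A hA l hl; omega
    calc 2 ^ ((L ∪ A) ∩ insert x l).card ≤ 2 ^ 2 := Nat.pow_le_pow_right (by norm_num) hc
      _ = 4 := by norm_num
  · exfalso
    apply h2
    intro y hy
    have hy' := h1.2 (Finset.mem_union_left _ hy)
    rw [Finset.mem_union, Finset.mem_union, Finset.mem_insert] at hy'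
    rw [Finset.mem_union]
    rcases hy' with (hyL | hyA) | hyx | hyl
    · exact absurd hyL (Finset.disjoint_left.1 h.disj hy)
    · exact Or.inl hyA
    · rw [hyx] at hy
      exact absurd hx (Finset.disjoint_left.1 h.disj hy)
    · exact Or.inr hyl
  · exact Nat.zero_le _
  · exact le_refl 0

/-- At most one non-class line trace covers a class, and if one does, the class is counted by `covOld`:
`#{λ ∈ N : ρ ⊆ λ_j ∪ λ} ≤ [ν_{p − s_j} > 0 ∨ ν_{p − s_j + 1} > 0]`. -/
theorem card_filter_cov_le (h : PLTraceData π ρ L C N) {A : Finset α} (hA : A ∈ C) :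
    (N.filter fun l => ρ ⊆ A ∪ l).card ≤
      if 0 < PL.nu π (π.p - A.card) ∨ 0 < PL.nu π (π.p - A.card + 1) then 1 else 0 := by
  split_ifs with hc
  · rw [Finset.card_le_one]
    intro l hl l' hl'
    rw [Finset.mem_filter] at hl hl'
    by_contra hne
    have hsub : ρ \ A ⊆ l ∩ l' := by
      intro y hy
      rw [Finset.mem_sdiff] at hy
      rw [Finset.mem_inter]
      have h1 := hl.2 hy.1
      have h2 := hl'.2 hy.1
      rw [Finset.mem_union] at h1 h2
      exact ⟨h1.resolve_left hy.2, h2.resolve_left hy.2⟩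
    have hcard : 2 ≤ (ρ \ A).card := by
      rw [Finset.card_sdiff_of_subset (h.class_subset A hA)]
      have := h.cap A hA
      omega
    have := (Finset.card_le_card hsub).trans (h.line_line l hl.1 l' hl'.1 hne)
    omega
  · rw [Nat.le_zero, Finset.card_eq_zero, Finset.filter_eq_empty_iff]
    intro l hl hcov
    apply hc
    -- `λ = (ρ ∖ λ_j) ∪ (λ ∩ λ_j)`, so `|λ| ∈ {p − s_j, p − s_j + 1}`
    have hsplit : l = (ρ \ A) ∪ (l ∩ A) := by
      ext y
      rw [Finset.mem_union, Finset.mem_sdiff, Finset.mem_inter]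
      constructor
      · intro hy
        by_cases hyA : y ∈ A
        · exact Or.inr ⟨hy, hyA⟩
        · exact Or.inl ⟨h.line_subset l hl hy, hyA⟩
      · rintro (⟨hyρ, hyA⟩ | ⟨hy, -⟩)
        · have := hcov hyρ
          rw [Finset.mem_union] at this
          exact this.resolve_left hyA
        · exact hy
    have hdisj' : Disjoint (ρ \ A) (l ∩ A) := by
      rw [Finset.disjoint_left]
      intro y hy hy'
      exact (Finset.mem_sdiff.1 hy).2 (Finset.mem_inter.1 hy').2
    have hcardl : l.card = (ρ \ A).card + (l ∩ A).card := by
      rw [hsplit, Finset.card_union_of_disjoint hdisj', ← hsplit]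
    rw [Finset.card_sdiff_of_subset (h.class_subset A hA)] at hcardl
    have hle : (l ∩ A).card ≤ 1 := by
      rw [Finset.inter_comm]
      exact h.class_line A hA l hl
    have hpos := h.nu_pos l hl
    have hp := h.p_eq
    rcases Nat.le_one_iff_eq_zero_or_eq_one.1 hle with h0 | h1
    · left
      rw [h0, Nat.add_zero] at hcardl
      rw [hp, ← hcardl]
      exact hpos
    · right
      rw [h1] at hcardl
      rw [hp, ← hcardl]
      exact hpos

end accounting

end PercRepro.SixFour
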